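import Summits.QuantumFields.YangMills.Theorems.BalabanUVNodesN22W1StripLastCoupling

/-!
# BalabanUVNodes ∕ node N22 = NE9 — THE STRIP INDUCTION AT THE W1 OBJECT, MODULE 12: THE CHAIN END TO END AT ANY W1 READING (pin-agnostic) —
# `N22At` at the level-`k` Stage-12 bundle of a GENERIC `W1.ReadingData` from the OLDER-coupling level-T hypothesis (N10), an `EHoloAt` family on the tower of
# W1's terms (N09's currency), node N18 below, the pairing coherence (C1)(C2), the junk-freeness pin (J), the readings-in-the-spaces clause ON THE ABSTRACT
# run-A background type, and numerals; and the ₁₂ EDGE `S_N18 (RRec₁₂ 𝔯_W1) → … → S_N22 (RRec₁₂ 𝔯_W1)` in θ-form with the Lemma-3 ∕ N09 data existential per tuple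

Cell `pub-ymgap`, HUMAN RULING D-0062 (Track A), R134 ACCELERATION re-seat `pub-ymgap-dag-n22-c` (strategy s1), generation 3, module 12.  THEOREMS ONLY; imports module 11
`…N22W1StripLastCoupling` (p478264; through it modules 8–10, node00-def-W1's `RateRecordW1Reading` ∕ `RateRecordW1Maps`, layer B ₁₂) BY NAME.  `--supports` K3′ (helper).

WHY (pub-ymgap INBOX, this seat's LOCATED-BGA, 2026-08-27).  Modules 10–11 instantiate the chain at node00-def-W1 g3's `ReadingData.ofRecord`, whose run-A ∕ run-B
background types are ALL `SU(N)` gauge fields; there the readings-in-the-spaces clause `∀ U, (ιU, 0) ∈ U^c_j(Y, α₀, α₁)` is false at the record's radii (a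
plaquette of eigenvalue `−1` has `‖u(∂U − 1)u⁻¹‖ ≥ 2` on its whole `Gᶜ`-orbit, against `CondI.plaq_lt : ‖∂U − 1‖ < α₀ξ²`), so those instances are located-vacuous in
that clause until the definer lane types the intended restriction of the background slots to ADMISSIBLE backgrounds (repair (R1): `BgA_k := {U // ∀ j Y, (ιU,0) ∈
sp k j Y}`, `embA := (ι·, 0) ∘ Subtype.val`).  This module states the end of the chain ONCE, for a GENERIC `D : W1.ReadingData F 𝔸 M` with the clause carried on the
ABSTRACT type `(D.pairing k).BgA` — so that any reading whose run-A slot is an admissible-background subtype discharges it BY TYPE (`U.2`) — and the ₁₂ edge in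
θ-form with every numeric ∕ N09 ∕ N10 datum existential per admissible tuple and run length.

WHAT.
* §1 `n22At_u3OfRecord₁₂_w1Reading_of_n18Below_termwise226StripOlder_eHoloAt` — for `D : ReadingData F 𝔸 M` (`𝔸` a complete normed `ℂ`-algebra), window `]0, θ.γ]`,
  run length `k`, a §2 setting `Sg : Sect2.Setting 𝔸 G`, residual recipes `Rz`, normalizations `logZ`, `β`, N09 letters `cs`: readings `(D.pairing k).embA U ∈
  U^c_j(Y, cs.α₀, cs.α₁)` for every `U : (D.pairing k).BgA` + the older-coupling level-T hypothesis for `D.S k` at the spaces of record + one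
  `EHoloAt (sfTowerOfRecord Sg Rz M (D.S k) ⟨g, β⟩ logZ) cs k′` per window history and step (`H.E₀ ≤ li.A`, `li.r ≤ H.r`; `θ.γ ≤ cs.γ`, `li.κ ≤ cs.κ`) + the socket numerals,
  S25, the renewal + (C1)(C2)(J) + `∀ k′ < k, N18At (u3OfRecord₁₂ θ (D.u3Objects θ.γ) k′)` + the letter signs ⟹ `N22At (u3OfRecord₁₂ θ (D.u3Objects θ.γ) k)`
  (module 9 §2 ∘ module 11 §1).
* §2 `s_N22_rRec₁₂_w1Assignment_of_s_N18_termwise226StripOlder_eHoloAt` — THE ₁₂ EDGE, θ-form, for `𝔯_W1 := RateReading₁₂.ofAssignment (W1.assignment₁₂ 𝔇) ne1`: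
  `S_N18 (RRec₁₂ 𝔯_W1)` + per admissible Stage-12 tuple with provisos: coherence + (J) + signs, and per run length `k` the EXISTENCE of the §1 data (a §2 setting with
  its residual recipes and normalizations, N09 letters and an `EHoloAt` family, socket constants with their numerals, the readings clause, the older-coupling level-T
  hypothesis) ⟹ `S_N22 (RRec₁₂ 𝔯_W1)`.

HONEST FRAMING.  Count-neutral by-name knit; NOT a discharge of N22 — every analytic input is a HYPOTHESIS in a named neighbour's currency (N09 `EHoloAt`, N10 the
older-coupling termwise-(2.26)-on-the-strip, N18 `N18At`∕`S_N18`), the readings clause is Theorem-1 content on the abstract background slot, (C1)(C2) definer faces, (J) a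
reading pin, the numerals the reading's; no inhabitant of `IsDatumOfRecord₁₂C` claimed (K0′).  NE5 ∕ NE9 NOT IN PRINT; one finite four-torus programme at fixed ε —
NOT infinite volume, NOT OS on ℝ⁴, NOT a mass gap, NOT Clay.  0 `sorry`, 0 `def`, standard axioms.

References (TYPES only): [I] = [Balaban1987RG1] (0.24)–(0.25) p. 257, (1.11)–(1.16) p. 262, (1.18) p. 263, pp. 266–267; [II] = [Balaban1988RG2Cluster] (2.13)–(2.15)
pp. 14–15, (2.26) p. 17, (2.38)–(2.41) pp. 20–21.
-/

noncomputable section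

open scoped Matrix.Norms.L2Operator

namespace YMDAG.N22.W1

open Set Metric
open scoped BigOperators
open Literature.MathematicalPhysics.QuantumFieldTheory.Balaban1983to89
open Literature.MathematicalPhysics.QuantumFieldTheory.Balaban1983to89.T4Continuum
open Literature.MathematicalPhysics.QuantumFieldTheory.Balaban1983to89.T4OutputRate
open Literature.MathematicalPhysics.QuantumFieldTheory.Balaban1983to89.TreeLengthTorus (TPt TDom tsys torusTreeLen torusTreeLen_nonneg)
open Literature.MathematicalPhysics.QuantumFieldTheory.Balaban1983to89.B12TreeDecay (K₀ K₀_pos)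
open Literature.MathematicalPhysics.QuantumFieldTheory.Balaban1983to89.B13Lemma3TorusData (TBond)
open Literature.MathematicalPhysics.QuantumFieldTheory.Balaban1983to89.B13Lemma3TorusTerms (terms weight)
open Literature.MathematicalPhysics.QuantumFieldTheory.Balaban1983to89.B13Lemma3TorusSocket (Lemma3Numerics)
open Literature.MathematicalPhysics.QuantumFieldTheory.Balaban1983to89.B12BetaHolo (EHoloAt)
open Literature.MathematicalPhysics.QuantumFieldTheory.Balaban1983to89.Step (SFConsts)
open Literature.MathematicalPhysics.QuantumFieldTheory.Balaban1983to89.Node00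
  (Stage12Params IsDatumOfRecord₁₂C U3Objects₁₁ U3Letters₁₁ MatA prependCoupling)
open Literature.MathematicalPhysics.QuantumFieldTheory.Balaban1983to89.Node00.Sect2 (domSys domCount CPair ofBackgroundC spaceI domSites Setting Residual)
open Literature.MathematicalPhysics.QuantumFieldTheory.Balaban1983to89.Node00.W1
open YMDAG.UVSplit

variable {N : ℕ} [NeZero N]

/-! ## §1 `N22At` at a generic reading from the older-coupling level-T hypothesis + `EHoloAt` + node N18 below — readings clause on the abstract slot -/

section AnyReading

variable {F : T4Family} (θ : Stage12Params F N) {𝔸 : Type*} [NormedRing 𝔸] [NormedAlgebra ℂ 𝔸] [CompleteSpace 𝔸] {G : Type*} [GaugeGroup G]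
  {M : ℕ} (D : ReadingData F 𝔸 M) (k : ℕ)
  (Sg : Setting 𝔸 G) (Rz : Residual (F.P k) 𝔸) (logZ : ℕ → GaugeField (F.P k) 0 G → ℝ) (β : ℕ → ℝ → ℝ)

open Classical in
/-- **`N22At` AT THE LEVEL-`k` BUNDLE OF ANY W1 READING, END TO END** (module 9 §2's `n22At_u3OfRecord₁₂_w1Reading_of_n18Below_stripBound` with STRIP from module 11 §1's
`stripBound_termC_of_termwise226StripOlder_eHoloAt` for the tower `D.S k` at the space table of record `U^c_j(Y, cs.α₀, cs.α₁)`): readings of the ABSTRACT run-A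
backgrounds inside the spaces (`hsp` — by type for an admissible-background slot), the older-coupling level-T hypothesis (N10's lane), an `EHoloAt` family on
`sfTowerOfRecord Sg Rz M (D.S k) ⟨g, β⟩ logZ` (N09's currency), node N18 below `k`, (C1)(C2)(J), the socket numerals + S25 + renewal, the letter signs ⟹ `N22At`. [folklore] -/
theorem n22At_u3OfRecord₁₂_w1Reading_of_n18Below_termwise226StripOlder_eHoloAt [NeZero M] {cs : SFConsts}
    (hsp : ∀ (j : ℕ) (U : (D.pairing k).BgA) (Y : (domSys (F.P k) M j).Dom), (D.pairing k).embA U ∈ spaceI Sg Rz M j (domSites (F.P k) M j Y) cs.α₀ cs.α₁)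
    (c : B13.Consts) {L : ℕ} [NeZero L] (hL : 8 ≤ c.L) (hLc : c.L = L) {a a₂ a₂' a₅ Aabs : ℝ}
    (hN : Lemma3Numerics c M ((c.L : ℝ) / 2) a a₂ a₂' a₅ Aabs) {r₁ : ℝ} (hA0 : 0 ≤ c.C3act * c.ε₁) (hr₁ : 0 ≤ r₁) (hκ : D.li.κ ≤ r₁)
    (hrate : r₁ + 2 * (64 * Real.log 162) + 2 ≤ (1 - 8 * c.δ) * ((c.L : ℝ) / 2) * c.κ)
    (hsmall : c.C3act * c.ε₁ * Real.exp (5 * r₁ + 1) * K₀ 64 8 * 9 * 64 ≤ 1)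
    (hrenew : Real.exp 1 * 9 * 64 * K₀ 64 8 ^ 2 * (c.C3act * c.ε₁) ≤ D.li.A) (hγc : θ.γ ≤ cs.γ) (hκc : D.li.κ ≤ cs.κ)
    (h226TOlder : ∀ (k' : ℕ) (g : ℕ → ℝ), g ∈ Window θ.γ → ∀ (i : ℕ), i < k' → ∀ (X : (domSys (F.P k) M (k' + 1)).Dom) (φ : CPair (F.P k) 𝔸),
      φ ∈ spaceI Sg Rz M (k' + 1) (domSites (F.P k) M (k' + 1) X) cs.α₀ cs.α₁ →
      (∀ (j : ℕ), j < k' + 1 → ∀ (Y : (domSys (F.P k) M j).Dom) (ψ : CPair (F.P k) 𝔸), ψ ∈ spaceI Sg Rz M j (domSites (F.P k) M j Y) cs.α₀ cs.α₁ →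
        ∃ (Ec : ℂ → ℂ) (O : Set ℂ), IsOpen O ∧ (∀ t ∈ Ioc (0 : ℝ) θ.γ, closedBall (t : ℂ) D.li.r ⊆ O) ∧ DifferentiableOn ℂ Ec O ∧
          (∀ z ∈ O, ‖Ec z‖ ≤ D.li.A * Real.exp (-(D.li.κ * torusTreeLen Y.1))) ∧
          (∀ t ∈ Ioc (0 : ℝ) θ.γ, Ec t = termC (D.S k) j Y (Function.update g i t) ψ)) →
      ∃ (Hc : ℂ → TDom 4 (domCount (F.P k) M (k' + 1)) → ℂ)
        (Tt : (Z : TDom 4 (domCount (F.P k) M (k' + 1))) →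
          Finset (TDom 4 (L * domCount (F.P k) M (k' + 1))) × Finset (TBond 4 M (L * domCount (F.P k) M (k' + 1))) → ℂ → ℂ)
        (O : Set ℂ), IsOpen O ∧ (∀ t ∈ Ioc (0 : ℝ) θ.γ, closedBall (t : ℂ) D.li.r ⊆ O) ∧
        (∀ Z : (domSys (F.P k) M (k' + 1)).Dom, Z.1 ⊆ X.1 → DifferentiableOn ℂ (fun z => Hc z Z) O) ∧
        (∀ z ∈ O, ∀ Z : TDom 4 (domCount (F.P k) M (k' + 1)), Z.1 ⊆ X.1 → ‖Hc z Z‖ ≤ ∑ t ∈ terms L M Z, ‖Tt Z t z‖) ∧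
        (∀ z ∈ O, ∀ Z : TDom 4 (domCount (F.P k) M (k' + 1)), Z.1 ⊆ X.1 → ∀ t ∈ terms L M Z,
          ‖Tt Z t z‖ ≤ weight L M c Z a t * Real.exp (a₅ * ((Z.1).card : ℝ))) ∧
        (∀ t ∈ Ioc (0 : ℝ) θ.γ, Hc t = ((D.S k) k').H (restrictPrefix k' (Function.update g i t)) φ))
    (hE : ∀ g ∈ Window θ.γ, ∀ k' : ℕ, ∃ H : EHoloAt (sfTowerOfRecord Sg Rz M (D.S k) ⟨g, β⟩ logZ) cs k', H.E₀ ≤ D.li.A ∧ D.li.r ≤ H.r)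
    (hfst : ∀ (k : ℕ) (X₁ : Node00.W1.Dom (F.P k) M), ((D.pairing k).pair X₁).1 = X₁.1 + 1)
    (hdj : ∀ (k : ℕ) (X₁ : Node00.W1.Dom (F.P k) M),
      (domSys (F.P (k + 1)) M ((D.pairing k).pair X₁).1).dj ((D.pairing k).pair X₁).2 = (domSys (F.P k) M X₁.1).dj X₁.2)
    (hsurj : ∀ (k : ℕ) (X : Node00.W1.Dom (F.P (k + 1)) M), 1 ≤ X.1 → ∃ X₁ : Node00.W1.Dom (F.P k) M, (D.pairing k).pair X₁ = X)
    (hbg : ∀ (k : ℕ) (U : (D.pairing (k + 1)).BgA), ∃ U₁ : (D.pairing k).BgB, (D.pairing k).embB U₁ = (D.pairing (k + 1)).embA U)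
    (hjunk : ∀ (k : ℕ) (g : ℕ → ℝ) (U : (D.pairing k).BgA) (X : Node00.W1.Dom (F.P k) M), k < X.1 → (D.pairing k).EA (D.S k) g U X = 0)
    (h18 : ∀ k' : ℕ, k' < k → N18At (u3OfRecord₁₂ θ (D.u3Objects θ.γ) k'))
    (hC5 : 0 ≤ D.li.C₅) (hθ1 : D.li.θ₅ < 1) (hC₀' : 2 * D.li.C₅ / (1 - D.li.θ₅) ≤ D.li.C₀)
    (hC₀ : 0 < D.li.C₀) (hθ : 0 < D.li.θ₅) (hA : 0 < D.li.A) (hμ1 : 1 ≤ D.li.μ) (hθμ : D.li.θ₅ ≤ D.li.μ) (hCM : D.li.C₀ ≤ 2 * D.li.A)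
    (hr : 0 < D.li.r) (hγ : 0 < θ.γ) (hs0 : 0 < D.li.s) (hs1 : D.li.s < 1) :
    N22At (u3OfRecord₁₂ θ (D.u3Objects θ.γ) k) :=
  n22At_u3OfRecord₁₂_w1Reading_of_n18Below_stripBound θ D k (fun j Y => spaceI Sg Rz M j (domSites (F.P k) M j Y) cs.α₀ cs.α₁) hsp
    (stripBound_termC_of_termwise226StripOlder_eHoloAt F k Sg Rz logZ β (D.S k) c hL hLc hN hr.le hA0 hr₁ hκ hrate hsmall hrenew hγc hκc h226TOlder hE)
    hfst hdj hsurj hbg hjunk h18 hC5 hθ1 hC₀' hC₀ hθ hA hμ1 hθμ hCM hr hγ hs0 hs1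

end AnyReading

/-! ## §2 THE ₁₂ EDGE, θ-form, with the Lemma-3 ∕ N09 ∕ N10 data existential per admissible tuple and run length -/

section RecordEdge

variable (𝔇 : AssignmentInputs₁₂ N) (ne1 : (F : T4Family) → Stage12Params F N → (ℕ → ℝ) → List (ULoop F) → NE1pCarriers) {G : Type*} [GaugeGroup G]

open Classical in
/-- **THE EDGE N18 → N22 AT THE NAMED W1 READING OF RECORD FROM NAMED NEIGHBOURS' CURRENCIES (θ-form).**  For `𝔯_W1 := RateReading₁₂.ofAssignment (W1.assignment₁₂ 𝔇) ne1`: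
node N18's stub `S_N18 (RRec₁₂ 𝔯_W1)` + per admissible Stage-12 tuple with provisos: the pairing coherence (C1)(C2) and junk-freeness (J) of `𝔇.w1 F θ`, the letter
signs (module 9 §3's twelve), and per run length `k` the EXISTENCE of: `NeZero θ.τ9.M`, a §2 setting `Sg : Sect2.Setting (M_N(ℂ)) G` with residual recipes `Rz` and
normalizations `logZ`, `β`, N09 letters `cs` with `θ.γ ≤ cs.γ`, `li.κ ≤ cs.κ`, socket constants `c` with `8 ≤ c.L`, a block factor `L = c.L` with `NeZero L`, the numerals
`Lemma3Numerics c θ.τ9.M (½c.L) a a₂ a₂′ a₅ Aabs`, `0 ≤ C₃ε₁`, `0 ≤ r₁`, `li.κ ≤ r₁`, S25's two clauses, the renewal `e·9·64·K₀(64,8)²·C₃ε₁ ≤ li.A`, the readings clause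
`embA U ∈ U^c_j(Y, cs.α₀, cs.α₁)` on the abstract run-A slot, the OLDER-coupling level-T hypothesis for `(𝔇.w1 F θ).S k` (N10's lane), and an `EHoloAt` family on
`sfTowerOfRecord Sg Rz θ.τ9.M ((𝔇.w1 F θ).S k) ⟨g, β⟩ logZ` along `]0, θ.γ]^ℕ` with `H.E₀ ≤ li.A`, `li.r ≤ H.r` (N09's currency) ⟹ `S_N22 (RRec₁₂ 𝔯_W1)`.  Datum form via
dag-n22-e's `s_N22_rRec₁₂_w1_iff` + layer B's `s_N18_rRec₁₂_iff`, then §1. [folklore] -/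
theorem s_N22_rRec₁₂_w1Assignment_of_s_N18_termwise226StripOlder_eHoloAt
    (h18 : S_N18 (RRec₁₂ (RateReading₁₂.ofAssignment (assignment₁₂ 𝔇) ne1)))
    (hcoh : ∀ (F : T4Family) (θ : Stage12Params F N), θ.Provisos₁₂ F N → θ.Admissible F N →
      (∀ (k : ℕ) (X₁ : Node00.W1.Dom (F.P k) θ.τ9.M), (((𝔇.w1 F θ).pairing k).pair X₁).1 = X₁.1 + 1) ∧
      (∀ (k : ℕ) (X₁ : Node00.W1.Dom (F.P k) θ.τ9.M),
        (domSys (F.P (k + 1)) θ.τ9.M (((𝔇.w1 F θ).pairing k).pair X₁).1).dj (((𝔇.w1 F θ).pairing k).pair X₁).2 =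
          (domSys (F.P k) θ.τ9.M X₁.1).dj X₁.2) ∧
      (∀ (k : ℕ) (X : Node00.W1.Dom (F.P (k + 1)) θ.τ9.M), 1 ≤ X.1 → ∃ X₁ : Node00.W1.Dom (F.P k) θ.τ9.M, ((𝔇.w1 F θ).pairing k).pair X₁ = X) ∧
      (∀ (k : ℕ) (U : ((𝔇.w1 F θ).pairing (k + 1)).BgA), ∃ U₁ : ((𝔇.w1 F θ).pairing k).BgB,
        ((𝔇.w1 F θ).pairing k).embB U₁ = ((𝔇.w1 F θ).pairing (k + 1)).embA U) ∧
      (∀ (k : ℕ) (g : ℕ → ℝ) (U : ((𝔇.w1 F θ).pairing k).BgA) (X : Node00.W1.Dom (F.P k) θ.τ9.M), k < X.1 →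
        ((𝔇.w1 F θ).pairing k).EA ((𝔇.w1 F θ).S k) g U X = 0))
    (hnum : ∀ (F : T4Family) (θ : Stage12Params F N), θ.Provisos₁₂ F N → θ.Admissible F N →
      0 < (𝔇.w1 F θ).li.C₀ ∧ 0 < (𝔇.w1 F θ).li.θ₅ ∧ (𝔇.w1 F θ).li.θ₅ < 1 ∧ 0 ≤ (𝔇.w1 F θ).li.C₅ ∧
        2 * (𝔇.w1 F θ).li.C₅ / (1 - (𝔇.w1 F θ).li.θ₅) ≤ (𝔇.w1 F θ).li.C₀ ∧ 0 < (𝔇.w1 F θ).li.A ∧ (𝔇.w1 F θ).li.θ₅ ≤ (𝔇.w1 F θ).li.μ ∧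
        (𝔇.w1 F θ).li.C₀ ≤ 2 * (𝔇.w1 F θ).li.A ∧ 0 < (𝔇.w1 F θ).li.r ∧ 0 < (𝔇.w1 F θ).li.s ∧ (𝔇.w1 F θ).li.s < 1 ∧ 1 ≤ (𝔇.w1 F θ).li.μ)
    (hT : ∀ (F : T4Family) (θ : Stage12Params F N), θ.Provisos₁₂ F N → θ.Admissible F N → ∀ (k : ℕ),
      ∃ (_ : NeZero θ.τ9.M) (Sg : Setting (MatA N) G) (Rz : Residual (F.P k) (MatA N)) (logZ : ℕ → GaugeField (F.P k) 0 G → ℝ) (β : ℕ → ℝ → ℝ)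
        (cs : SFConsts) (c : B13.Consts) (L : ℕ) (_ : NeZero L) (a a₂ a₂' a₅ Aabs r₁ : ℝ),
        (∀ (j : ℕ) (U : ((𝔇.w1 F θ).pairing k).BgA) (Y : (domSys (F.P k) θ.τ9.M j).Dom),
          ((𝔇.w1 F θ).pairing k).embA U ∈ spaceI Sg Rz θ.τ9.M j (domSites (F.P k) θ.τ9.M j Y) cs.α₀ cs.α₁) ∧
        8 ≤ c.L ∧ c.L = L ∧ Lemma3Numerics c θ.τ9.M ((c.L : ℝ) / 2) a a₂ a₂' a₅ Aabs ∧ 0 ≤ c.C3act * c.ε₁ ∧ 0 ≤ r₁ ∧ (𝔇.w1 F θ).li.κ ≤ r₁ ∧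
        r₁ + 2 * (64 * Real.log 162) + 2 ≤ (1 - 8 * c.δ) * ((c.L : ℝ) / 2) * c.κ ∧
        c.C3act * c.ε₁ * Real.exp (5 * r₁ + 1) * K₀ 64 8 * 9 * 64 ≤ 1 ∧
        Real.exp 1 * 9 * 64 * K₀ 64 8 ^ 2 * (c.C3act * c.ε₁) ≤ (𝔇.w1 F θ).li.A ∧ θ.γ ≤ cs.γ ∧ (𝔇.w1 F θ).li.κ ≤ cs.κ ∧
        (∀ (k' : ℕ) (g : ℕ → ℝ), g ∈ Window θ.γ → ∀ (i : ℕ), i < k' → ∀ (X : (domSys (F.P k) θ.τ9.M (k' + 1)).Dom) (φ : CPair (F.P k) (MatA N)),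
          φ ∈ spaceI Sg Rz θ.τ9.M (k' + 1) (domSites (F.P k) θ.τ9.M (k' + 1) X) cs.α₀ cs.α₁ →
          (∀ (j : ℕ), j < k' + 1 → ∀ (Y : (domSys (F.P k) θ.τ9.M j).Dom) (ψ : CPair (F.P k) (MatA N)),
            ψ ∈ spaceI Sg Rz θ.τ9.M j (domSites (F.P k) θ.τ9.M j Y) cs.α₀ cs.α₁ →
            ∃ (Ec : ℂ → ℂ) (O : Set ℂ), IsOpen O ∧ (∀ t ∈ Ioc (0 : ℝ) θ.γ, closedBall (t : ℂ) (𝔇.w1 F θ).li.r ⊆ O) ∧ DifferentiableOn ℂ Ec O ∧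
              (∀ z ∈ O, ‖Ec z‖ ≤ (𝔇.w1 F θ).li.A * Real.exp (-((𝔇.w1 F θ).li.κ * torusTreeLen Y.1))) ∧
              (∀ t ∈ Ioc (0 : ℝ) θ.γ, Ec t = termC ((𝔇.w1 F θ).S k) j Y (Function.update g i t) ψ)) →
          ∃ (Hc : ℂ → TDom 4 (domCount (F.P k) θ.τ9.M (k' + 1)) → ℂ)
            (Tt : (Z : TDom 4 (domCount (F.P k) θ.τ9.M (k' + 1))) →
              Finset (TDom 4 (L * domCount (F.P k) θ.τ9.M (k' + 1))) × Finset (TBond 4 θ.τ9.M (L * domCount (F.P k) θ.τ9.M (k' + 1))) → ℂ → ℂ)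
            (O : Set ℂ), IsOpen O ∧ (∀ t ∈ Ioc (0 : ℝ) θ.γ, closedBall (t : ℂ) (𝔇.w1 F θ).li.r ⊆ O) ∧
            (∀ Z : (domSys (F.P k) θ.τ9.M (k' + 1)).Dom, Z.1 ⊆ X.1 → DifferentiableOn ℂ (fun z => Hc z Z) O) ∧
            (∀ z ∈ O, ∀ Z : TDom 4 (domCount (F.P k) θ.τ9.M (k' + 1)), Z.1 ⊆ X.1 → ‖Hc z Z‖ ≤ ∑ t ∈ terms L θ.τ9.M Z, ‖Tt Z t z‖) ∧
            (∀ z ∈ O, ∀ Z : TDom 4 (domCount (F.P k) θ.τ9.M (k' + 1)), Z.1 ⊆ X.1 → ∀ t ∈ terms L θ.τ9.M Z,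
              ‖Tt Z t z‖ ≤ weight L θ.τ9.M c Z a t * Real.exp (a₅ * ((Z.1).card : ℝ))) ∧
            (∀ t ∈ Ioc (0 : ℝ) θ.γ, Hc t = (((𝔇.w1 F θ).S k) k').H (restrictPrefix k' (Function.update g i t)) φ)) ∧
        (∀ g ∈ Window θ.γ, ∀ k' : ℕ,
          ∃ H : EHoloAt (sfTowerOfRecord Sg Rz θ.τ9.M ((𝔇.w1 F θ).S k) ⟨g, β⟩ logZ) cs k', H.E₀ ≤ (𝔇.w1 F θ).li.A ∧ (𝔇.w1 F θ).li.r ≤ H.r)) :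
    S_N22 (RRec₁₂ (RateReading₁₂.ofAssignment (assignment₁₂ 𝔇) ne1)) := by
  rw [YMDAG.N22.s_N22_rRec₁₂_w1_iff]
  intro F D h k
  have h18' : ∀ k' : ℕ, N18At (u3OfRecord₁₂ h.params ((𝔇.w1 F h.params).u3Objects h.params.γ) k') :=
    fun k' => (s_N18_rRec₁₂_iff (RateReading₁₂.ofAssignment (assignment₁₂ 𝔇) ne1)).1 h18 F D h (fun _ => 0) [] k'
  obtain ⟨hfst, hdj, hsurj, hbg, hjunk⟩ := hcoh F h.params h.provisos h.admissible
  obtain ⟨hC₀, hθ, hθ1, hC5, hC₀', hA, hθμ, hCM, hr, hs0, hs1, hμ1⟩ := hnum F h.params h.provisos h.admissible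
  obtain ⟨hMz, Sg, Rz, logZ, β, cs, c, L, hLz, a, a₂, a₂', a₅, Aabs, r₁, hsp, hL, hLc, hN, hA0, hr₁, hκ, hrate, hsmall, hrenew, hγc, hκc, h226TOlder, hE⟩ :=
    hT F h.params h.provisos h.admissible k
  exact n22At_u3OfRecord₁₂_w1Reading_of_n18Below_termwise226StripOlder_eHoloAt h.params (𝔇.w1 F h.params) k Sg Rz logZ β hsp c hL hLc hN hA0 hr₁ hκ
    hrate hsmall hrenew hγc hκc h226TOlder hE hfst hdj hsurj hbg hjunk (fun k' _ => h18' k') hC5 hθ1 hC₀' hC₀ hθ hA hμ1 hθμ hCM hr h.gamma_pos hs0 hs1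

end RecordEdge

end YMDAG.N22.W1

end
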